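import Summits.AtomisticToContinuum.Crystallization.Theorems.ChargedEnergyGapFlatCorner
import Summits.AtomisticToContinuum.Crystallization.Theorems.ChargedEnergyGapMirrorUnit
import HarnessLib

/-!
# (T¹ᶜ) station certificates — NODE 113L «FlatUnit»: stations and sphere units checked through the flat corner block

decomp-a2c lens-3 g95.  Imports lane NODE 113K «FlatCorner» (`boxCostZ`, `StationCert.box_payload_soundZ`, `flatAll`) and tree (245) 113I
«MirrorUnit» (`Box3.swap12`, `StationRowsCert.symm12`, the `1 ↔ 2` relabelling lemmas), and through them tree 113D/113F (`checkDX`'s blocks,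
`sphRows`, `CellPart`, `sphere_cells_dispatch`).

* §113L.1 STATION LEVEL: `StationCert.checkDXZ c X extra Bs` = 113D `checkDX` with the box blocks read through 113K `boxCostZ (flatAll Bs)`
  (the slim bases `Bs` are an ARGUMENT; `c.bases` is consulted only at cone leaves); the leaf dispatch ONCE, generic in the box-payload
  PROPOSITION (`sound_leafG`), and ★★ `sound_dietXZ` with the binders and conclusion of 113D `sound_dietX` exactly.
* §113L.2 SPHERE CELLS: the sphere-cell law (the conclusion of 113F `sound_dietSph` verbatim) from `checkDXZ` (`sphLaw_of_checkDXZ`) and its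
  transport to the mirror cell LAW TO LAW (`sphLaw_swap12`, the argument of 113I `sound_dietSph_swap12`; no `Prop`-valued definition).
* §113L.3 THE FLAT UNIT `ZUnit`: the shared data of a 113F `SphUnit` and one `(CellPart, slim bases)` pair per cell; checkers `check` (cover
  over the cells) and `checkM` (cover over cells ++ mirror cells, 113I); ★★★ `ZUnit.sound` / `ZUnit.soundM` with the binders and the conclusion
  of 113F `SphUnit.sound` exactly.

Certificate files change only in plumbing: a part is `⟨⟨cell, expandAllC Bs, boxes, tree, caps⟩, Bs⟩` and `part_ok : … checkDXZ … Bs = true`.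
-/

namespace Summit.AtomisticToContinuum.Crystallization.Theorems.ChargedEnergyGapChartDial

open scoped Classical
open Literature.MathematicalPhysics.StatisticalMechanics Literature.Geometry.DiscreteGeometry
open Summit.AtomisticToContinuum.Crystallization.Theses.PricedLinkCensus
open Summit.AtomisticToContinuum.Crystallization.Theorems.ChargedEnergyGapNegative

/-! ## §113L.1 Station level -/
section Station

/-- The flat box block of a leaf inside a station: 113K `boxCostZ` and the absorbed cap comparison `kfac · R ≤ capLB · u`. -/
def StationCert.boxCheckZ (c : StationCert) (Fs : List FlatBasis) (b : BoxLeaf) : Bool :=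
  boxCostZ Fs b && decide (c.kfac * b.R ≤ c.capLB * c.u)

/-- ★ THE FLAT DIET CHECKER WITH EXTRA ROWS: 113D `checkDX` with the box blocks over the flat payloads of the slim bases `Bs`. -/
def StationCert.checkDXZ (c : StationCert) (X : DietCert) (extra : List LRow) (Bs : List BasisIdx) : Bool :=
  c.R.ok && decide (0 < c.R.rho0 ∧ 0 ≤ c.R.loC) && c.boxes.all (c.boxCheckZ (flatAll Bs)) &&
    c.caps.all (fun l => (c.capCertL l).capCheck 0) && c.capCert.capCheck 0 && X.ok c.R &&
    c.tree.checkBox c.needD c.R.bnd (c.R.rows ++ chamberRows ++ X.rows ++ extra)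

/-- ★★ THE LEAF DISPATCH, generic in the BOX PAYLOAD PROPOSITION (113B `sound_leaf` with the box leaves' block read as a `Prop`). -/
theorem StationCert.sound_leafG (c : StationCert) (CAPOK : CostCellCert → Prop) {dt : (Fin 3 → ℤ) → ℝ}
    (hboxes : ∀ b ∈ c.boxes, (∀ capLB : ℚ, ((c.kfac * b.R : ℚ) : ℝ) ≤ ((capLB * c.u : ℚ) : ℝ) → (∀ r ∈ b.need, linAt r.a (sval dt) 0 ≤ (r.b : ℝ)) →
      (3 / 100 * (2 * (c.R.rho1 : ℝ))) ^ 2 * roofVal T75 (vtxW 160 dt 0) ≤ (capLB : ℝ) * c.u) ∧ c.kfac * b.R ≤ c.capLB * c.u)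
    (hcaps : ∀ l ∈ c.caps, CAPOK (c.capCertL l)) (hc : CAPOK c.capCert)
    {ρ : ℝ} (hρ : 0 < ρ) (h₁ : ρ ≤ c.R.rho1) (hbox : ∀ q, castW c.R.lo q ≤ dt (holeVertex 0 q) ∧ dt (holeVertex 0 q) ≤ castW c.R.hi q)
    (hfin : ∀ k : CostCellCert, k.rho0 = c.R.rho0 → k.rho1 = c.R.rho1 → k.u = c.u → CAPOK k →
      (∀ q, castW k.lo q ≤ dt (holeVertex 0 q) ∧ dt (holeVertex 0 q) ≤ castW k.hi q) → (k.capLB : ℝ) * c.u ≤ domCapK c.u 160 (3 / 100) ρ (chargeDepth ρ dt 0))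
    {π : Leaf} (hπ : ∀ r ∈ c.needD π, linAt r.a (sval dt) 0 ≤ (r.b : ℝ)) :
    feetHoleCost 160 (3 / 100) ρ dt 0 ≤ domCapK c.u 160 (3 / 100) ρ (chargeDepth ρ dt 0) := by
  have hcost := feetHoleCost_le_of_roofVal_le (ϱ := 160) (d := dt) (w := 0) (show (0 : ℝ) ≤ 3 / 100 by norm_num) hρ.le h₁ le_rfl
  have finish : ∀ (k : CostCellCert), k.rho0 = c.R.rho0 → k.rho1 = c.R.rho1 → k.u = c.u → CAPOK k →
      (∀ q, castW k.lo q ≤ dt (holeVertex 0 q) ∧ dt (holeVertex 0 q) ≤ castW k.hi q) →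
      (3 / 100 * (2 * (c.R.rho1 : ℝ))) ^ 2 * roofVal T75 (vtxW 160 dt 0) ≤ (k.capLB : ℝ) * c.u →
      feetHoleCost 160 (3 / 100) ρ dt 0 ≤ domCapK c.u 160 (3 / 100) ρ (chargeDepth ρ dt 0) :=
    fun k e0 e1 eu k0 hb hpay => hcost.trans (hpay.trans (hfin k e0 e1 eu k0 hb))
  cases π with
  | cone j =>
    simp only [StationCert.needD] at hπ
    split at hπ
    · exact absurd hπ (not_nilRow _)
    · split at hπ
      · next hB => exact finish c.capCert rfl rfl rfl hc hbox (c.payload_sound hB dt hπ)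
      · exact absurd hπ (not_nilRow _)
  | box j =>
    simp only [StationCert.needD] at hπ
    split at hπ
    · exact absurd hπ (not_nilRow _)
    · next b hb =>
      obtain ⟨hpay, hv⟩ := hboxes b (List.mem_of_getElem? hb)
      exact finish c.capCert rfl rfl rfl hc hbox (hpay _ (qle hv) hπ)
  | coneL j k =>
    simp only [StationCert.needD] at hπ
    split at hπ
    · next B l hB hl =>
      split at hπ
      · next hinv =>
        exact finish (c.capCertL l) rfl rfl rfl (hcaps l (List.mem_of_getElem? hl)) (l.box_of_need dt fun r hr => hπ r (List.mem_append_right _ hr))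
          (c.payload_sound hinv dt fun r hr => hπ r (List.mem_append_left _ hr))
      · exact absurd hπ (not_nilRow _)
    · exact absurd hπ (not_nilRow _)
  | boxL j k =>
    simp only [StationCert.needD] at hπ
    split at hπ
    · next b l hb hl =>
      obtain ⟨hpay, -⟩ := hboxes b (List.mem_of_getElem? hb)
      have hv : (0 : ℝ) ≤ ((l.capLB * c.u - c.kfac * b.R : ℚ) : ℝ) := by
        simpa [linAt] using hπ _ (List.mem_append_right _ (List.mem_singleton.2 rfl))
      refine finish (c.capCertL l) rfl rfl rfl (hcaps l (List.mem_of_getElem? hl))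
        (l.box_of_need dt fun r hr => hπ r (List.mem_append_left _ (List.mem_append_right _ hr)))
        (hpay _ ?_ fun r hr => hπ r (List.mem_append_left _ (List.mem_append_left _ hr)))
      change ((c.kfac * b.R : ℚ) : ℝ) ≤ ((l.capLB * c.u : ℚ) : ℝ)
      push_cast at hv ⊢
      linarith
    · exact absurd hπ (not_nilRow _)

/-- ★★ **SOUNDNESS OF THE FLAT CHECKER**: the binders and the conclusion of 113D `StationCert.sound_dietX` exactly. -/
theorem StationCert.sound_dietXZ (c : StationCert) (X : DietCert) (extra : List LRow) (Bs : List BasisIdx) (h : c.checkDXZ X extra Bs = true) :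
    ∀ ρ : ℝ, (c.R.rho0 : ℝ) ≤ ρ → ρ ≤ c.R.rho1 → ∀ dt : (Fin 3 → ℤ) → ℝ,
      (∀ q, castW c.R.lo q ≤ dt (holeVertex 0 q) ∧ dt (holeVertex 0 q) ≤ castW c.R.hi q) → ((c.R.loC : ℝ) ≤ dt 0 ∧ dt 0 ≤ c.R.hiC) →
      IsChartRealisable ρ dt → (∀ p ∈ stencil 0, 0 < dt p) → poleSum dt 0 ≤ poleSum dt 1 → poleSum dt 0 ≤ poleSum dt 2 →
      (∀ a : Fin 3, dt (holeVertex 0 (a, true)) ≤ dt (holeVertex 0 (a, false))) → (∀ r ∈ extra, linAt r.a (sval dt) 0 ≤ (r.b : ℝ)) →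
      feetHoleCost 160 (3 / 100) ρ dt 0 ≤ domCapK c.u 160 (3 / 100) ρ (chargeDepth ρ dt 0) := by
  simp only [StationCert.checkDXZ, Bool.and_eq_true, decide_eq_true_eq, List.all_eq_true] at h
  obtain ⟨⟨⟨⟨⟨⟨hok, hρ0, hloC⟩, hboxes⟩, hcaps⟩, hc0⟩, hX⟩, htree⟩ := h
  intro ρ h₀ h₁ dt hbox hC hreal hpos hch1 hch2 hchp hextra
  have hρ : 0 < ρ := lt_of_lt_of_le (by exact_mod_cast hρ0) h₀
  have hbox' : ∀ q, (c.R.lo q : ℝ) ≤ dt (holeVertex 0 q) ∧ dt (holeVertex 0 q) ≤ c.R.hi q := fun q => by simpa [castW_apply] using hbox q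
  have h7 := c.R.box7 hbox' hC
  obtain ⟨hsl, hnn⟩ := c.diet_prelim hok hloC
  have hrows : ∀ r ∈ c.R.rows ++ chamberRows ++ X.rows ++ extra, linAt r.a (sval dt) 0 ≤ (r.b : ℝ) := fun r hr => by
    rcases List.mem_append.1 hr with hr | hr
    · rcases List.mem_append.1 hr with hr | hr
      · rcases List.mem_append.1 hr with hr | hr
        · exact c.R.rows_sound hok h₀ h₁ hbox' hC hreal hpos r hr
        · exact chamberRows_sound dt hch1 hch2 hchp r hr
      · exact X.rows_sound hX hsl h7 r hr
    · exact hextra r hr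
  obtain ⟨π, hπ⟩ := c.tree.sound_box c.needD c.R.bnd (sval dt) (c.R.bnd_sound h7 hnn) _ htree hrows
  have hboxesP : ∀ b ∈ c.boxes, (∀ capLB : ℚ, ((c.kfac * b.R : ℚ) : ℝ) ≤ ((capLB * c.u : ℚ) : ℝ) →
      (∀ r ∈ b.need, linAt r.a (sval dt) 0 ≤ (r.b : ℝ)) → (3 / 100 * (2 * (c.R.rho1 : ℝ))) ^ 2 * roofVal T75 (vtxW 160 dt 0) ≤ (capLB : ℝ) * c.u) ∧
      c.kfac * b.R ≤ c.capLB * c.u := fun b hb => by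
    obtain ⟨hbz, hv⟩ := Bool.and_eq_true_iff.1 (hboxes b hb)
    exact ⟨fun capLB hle hneed => c.box_payload_soundZ hbz hle dt hneed, of_decide_eq_true hv⟩
  refine c.sound_leafG (fun k => k.capCheck 0 = true) hboxesP hcaps hc0 hρ h₁ hbox (fun k e0 e1 eu k0 hb => ?_) hπ
  have hdom := capCheck_zero_chamber k0 hρ (e0 ▸ h₀ :) (e1 ▸ h₁ :) hb hch1 hch2
  rwa [eu] at hdom

end Station

/-! ## §113L.2 Sphere cells: flat checking and mirror transport of the sphere-cell law -/
section Sphere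

/-- ★★ THE SPHERE-CELL LAW from the FLAT checker: the conclusion of 113F `StationCert.sound_dietSph` verbatim — (T¹ᶜ) for the FNF chamber
tuples of the station's slab × box whose centre direction satisfies the nine `cell` inequalities — from `checkDXZ` with the cell's rows. -/
theorem StationCert.sphLaw_of_checkDXZ (c : StationCert) (X : DietCert) (cell : Box3) (Bs : List BasisIdx)
    (h : c.checkDXZ X (sphRows cell c.R.rho0 c.R.rho1) Bs = true) :
    ∀ ρ : ℝ, (c.R.rho0 : ℝ) ≤ ρ → ρ ≤ c.R.rho1 → ∀ dt : (Fin 3 → ℤ) → ℝ,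
      (∀ q, castW c.R.lo q ≤ dt (holeVertex 0 q) ∧ dt (holeVertex 0 q) ≤ castW c.R.hi q) → ((c.R.loC : ℝ) ≤ dt 0 ∧ dt 0 ≤ c.R.hiC) →
      IsChartRealisable ρ dt → (∀ p ∈ stencil 0, 0 < dt p) → poleSum dt 0 ≤ poleSum dt 1 → poleSum dt 0 ≤ poleSum dt 2 →
      (∀ a : Fin 3, dt (holeVertex 0 (a, true)) ≤ dt (holeVertex 0 (a, false))) →
      (∀ a : Fin 3, dt (holeVertex 0 (a, true)) ^ 2 - dt 0 ^ 2 + 2 * (cell.lo a : ℝ) * c.R.rho0 * dt 0 ≤ (c.R.rho1 : ℝ) ^ 2) →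
      (∀ (a : Fin 3) (b : Bool), dt (holeVertex 0 (a, b)) ^ 2 - dt 0 ^ 2 - 2 * (cell.hi a : ℝ) * c.R.rho1 * dt 0 ≤ (c.R.rho1 : ℝ) ^ 2) →
      feetHoleCost 160 (3 / 100) ρ dt 0 ≤ domCapK c.u 160 (3 / 100) ρ (chargeDepth ρ dt 0) :=
  fun ρ h₀ h₁ dt hbox hC hreal hpos hch1 hch2 hchp hlo hhi =>
    c.sound_dietXZ X _ Bs h ρ h₀ h₁ dt hbox hC hreal hpos hch1 hch2 hchp (sphRows_holds hlo hhi)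

/-- ★★ MIRROR TRANSPORT of the sphere-cell law, LAW TO LAW (the argument of tree (245) 113I `sound_dietSph_swap12`, independent of the checker):
over a `1 ↔ 2`-symmetric box with `0 < ρ0`, the law on `cell` gives the law on `cell.swap12`. -/
theorem StationCert.sphLaw_swap12 {c : StationCert} {cell : Box3}
    (H : ∀ ρ : ℝ, (c.R.rho0 : ℝ) ≤ ρ → ρ ≤ c.R.rho1 → ∀ dt : (Fin 3 → ℤ) → ℝ,
        (∀ q, castW c.R.lo q ≤ dt (holeVertex 0 q) ∧ dt (holeVertex 0 q) ≤ castW c.R.hi q) → ((c.R.loC : ℝ) ≤ dt 0 ∧ dt 0 ≤ c.R.hiC) →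
        IsChartRealisable ρ dt → (∀ p ∈ stencil 0, 0 < dt p) → poleSum dt 0 ≤ poleSum dt 1 → poleSum dt 0 ≤ poleSum dt 2 →
        (∀ a : Fin 3, dt (holeVertex 0 (a, true)) ≤ dt (holeVertex 0 (a, false))) →
        (∀ a : Fin 3, dt (holeVertex 0 (a, true)) ^ 2 - dt 0 ^ 2 + 2 * (cell.lo a : ℝ) * c.R.rho0 * dt 0 ≤ (c.R.rho1 : ℝ) ^ 2) →
        (∀ (a : Fin 3) (b : Bool), dt (holeVertex 0 (a, b)) ^ 2 - dt 0 ^ 2 - 2 * (cell.hi a : ℝ) * c.R.rho1 * dt 0 ≤ (c.R.rho1 : ℝ) ^ 2) →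
        feetHoleCost 160 (3 / 100) ρ dt 0 ≤ domCapK c.u 160 (3 / 100) ρ (chargeDepth ρ dt 0))
    (hs : c.R.symm12 = true) (hρ0 : 0 < c.R.rho0) :
    ∀ ρ : ℝ, (c.R.rho0 : ℝ) ≤ ρ → ρ ≤ c.R.rho1 → ∀ dt : (Fin 3 → ℤ) → ℝ,
      (∀ q, castW c.R.lo q ≤ dt (holeVertex 0 q) ∧ dt (holeVertex 0 q) ≤ castW c.R.hi q) → ((c.R.loC : ℝ) ≤ dt 0 ∧ dt 0 ≤ c.R.hiC) →
      IsChartRealisable ρ dt → (∀ p ∈ stencil 0, 0 < dt p) → poleSum dt 0 ≤ poleSum dt 1 → poleSum dt 0 ≤ poleSum dt 2 →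
      (∀ a : Fin 3, dt (holeVertex 0 (a, true)) ≤ dt (holeVertex 0 (a, false))) →
      (∀ a : Fin 3, dt (holeVertex 0 (a, true)) ^ 2 - dt 0 ^ 2 + 2 * (cell.swap12.lo a : ℝ) * c.R.rho0 * dt 0 ≤ (c.R.rho1 : ℝ) ^ 2) →
      (∀ (a : Fin 3) (b : Bool), dt (holeVertex 0 (a, b)) ^ 2 - dt 0 ^ 2 - 2 * (cell.swap12.hi a : ℝ) * c.R.rho1 * dt 0 ≤ (c.R.rho1 : ℝ) ^ 2) →
      feetHoleCost 160 (3 / 100) ρ dt 0 ≤ domCapK c.u 160 (3 / 100) ρ (chargeDepth ρ dt 0) := by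
  intro ρ h₀ h₁ dt hbox hC hreal hpos hch1 hch2 hchp hlo hhi
  have hρ : (0 : ℝ) < ρ := lt_of_lt_of_le (by exact_mod_cast hρ0) h₀
  have hv : ∀ (a : Fin 3) (b : Bool), tupleRelabel 1 0 dt (holeVertex 0 (a, b)) = dt (holeVertex 0 (axp 1 a, b)) := fun a b => by
    rw [tupleRelabel_vertex, relabel_one_zero]
  have h0 : tupleRelabel 1 0 dt 0 = dt 0 := tupleRelabel_zero 1 0 dt
  have hp0 : poleSum (tupleRelabel 1 0 dt) 0 = poleSum dt 0 := by rw [poleSum_tupleRelabel, axp_one.1]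
  have hp1 : poleSum (tupleRelabel 1 0 dt) 1 = poleSum dt 2 := by rw [poleSum_tupleRelabel, axp_one.2.1]
  have hp2 : poleSum (tupleRelabel 1 0 dt) 2 = poleSum dt 1 := by rw [poleSum_tupleRelabel, axp_one.2.2]
  have hbox' : ∀ q, castW c.R.lo q ≤ tupleRelabel 1 0 dt (holeVertex 0 q) ∧ tupleRelabel 1 0 dt (holeVertex 0 q) ≤ castW c.R.hi q := by
    intro q
    have hb := hbox (relabel 1 0 q)
    rw [castW_apply, castW_apply, (c.R.symm12_spec hs q).1, (c.R.symm12_spec hs q).2] at hb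
    rw [tupleRelabel_vertex, castW_apply, castW_apply]
    exact hb
  have hC' : (c.R.loC : ℝ) ≤ tupleRelabel 1 0 dt 0 ∧ tupleRelabel 1 0 dt 0 ≤ c.R.hiC := by rw [h0]; exact hC
  have hchp' : ∀ a : Fin 3, tupleRelabel 1 0 dt (holeVertex 0 (a, true)) ≤ tupleRelabel 1 0 dt (holeVertex 0 (a, false)) := fun a => by
    rw [hv, hv]; exact hchp (axp 1 a)
  have hlo' : ∀ a : Fin 3, tupleRelabel 1 0 dt (holeVertex 0 (a, true)) ^ 2 - tupleRelabel 1 0 dt 0 ^ 2 +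
      2 * (cell.lo a : ℝ) * c.R.rho0 * tupleRelabel 1 0 dt 0 ≤ (c.R.rho1 : ℝ) ^ 2 := fun a => by
    rw [hv, h0, ← Box3.swap12_lo cell a]; exact hlo (axp 1 a)
  have hhi' : ∀ (a : Fin 3) (b : Bool), tupleRelabel 1 0 dt (holeVertex 0 (a, b)) ^ 2 - tupleRelabel 1 0 dt 0 ^ 2 -
      2 * (cell.hi a : ℝ) * c.R.rho1 * tupleRelabel 1 0 dt 0 ≤ (c.R.rho1 : ℝ) ^ 2 := fun a b => by
    rw [hv, h0, ← Box3.swap12_hi cell a]; exact hhi (axp 1 a) b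
  have hlaw := H ρ h₀ h₁ (tupleRelabel 1 0 dt) hbox' hC' (isChartRealisable_tupleRelabel 1 0 hreal)
    (pos_tupleRelabel 1 0 hpos) (by rw [hp0, hp1]; exact hch2) (by rw [hp0, hp2]; exact hch1) hchp' hlo' hhi'
  rwa [feetHoleCost_tupleRelabel, chargeDepth_tupleRelabel 1 0 hρ.ne'] at hlaw

end Sphere

/-! ## §113L.3 The flat unit -/
section Unit

/-- A FLAT PART: a 113F `CellPart` together with its slim bases (the argument of `checkDXZ`; `part.bases` serves the cone leaves only). -/
structure ZPart where
  /-- the cell part -/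
  part : CellPart
  /-- the slim bases -/
  slim : List BasisIdx

/-- ★ A FLAT UNIT: the shared data of a 113F `SphUnit` and one flat part per cell. -/
structure ZUnit where
  /-- the shared H-description (110D) -/
  R : StationRowsCert
  /-- the unit of `domCapK` -/
  u : ℚ
  /-- certified cap lower bound (in units of `u`) -/
  capLB : ℚ
  /-- the three axis cap certificates (108C) -/
  cap : Fin 3 → AxisCap
  /-- the shared diet certificate (113B) -/
  X : DietCert
  /-- the cover of the direction sphere (113E) -/
  cover : CoverTree
  /-- the flat parts -/
  parts : List ZPart

/-- The station certificate of a part: shared data from the unit, partition data from the part. -/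
def ZUnit.station (U : ZUnit) (P : CellPart) : StationCert :=
  ⟨U.R, U.u, U.capLB, U.cap, P.bases, P.boxes, P.tree, P.caps⟩

/-- The unit's cell list (in part order). -/
def ZUnit.cells (U : ZUnit) : List Box3 := U.parts.map (fun Z => Z.part.cell)

/-- The DOUBLED cell list (113I): the cells, then their mirrors. -/
def ZUnit.cellsM (U : ZUnit) : List Box3 := U.cells ++ U.cells.map Box3.swap12

/-- ★ THE FLAT UNIT CHECKER (shape of 113F `SphUnit.check`, parts through `checkDXZ`). -/
def ZUnit.check (U : ZUnit) : Bool :=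
  U.cover.check U.cells unitCube && U.cells.all (fun c => decide (0 ≤ c.l0 ∧ 0 ≤ c.l1 ∧ 0 ≤ c.l2)) && decide (0 ≤ U.R.rho0) &&
    U.parts.all (fun Z => (U.station Z.part).checkDXZ U.X (sphRows Z.part.cell U.R.rho0 U.R.rho1) Z.slim)

/-- ★ THE FLAT MIRROR CHECKER (shape of 113I `SphUnit.checkM`, parts through `checkDXZ`). -/
def ZUnit.checkM (U : ZUnit) : Bool :=
  U.cover.check U.cellsM unitCube && U.cellsM.all (fun c => decide (0 ≤ c.l0 ∧ 0 ≤ c.l1 ∧ 0 ≤ c.l2)) && decide (0 < U.R.rho0) && U.R.symm12 &&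
    U.parts.all (fun Z => (U.station Z.part).checkDXZ U.X (sphRows Z.part.cell U.R.rho0 U.R.rho1) Z.slim)

/-- ★★★ **SOUNDNESS OF A FLAT UNIT** — the binders and the conclusion of 113F `SphUnit.sound` exactly. -/
theorem ZUnit.sound (U : ZUnit) (h : U.check = true) :
    ∀ ρ : ℝ, (U.R.rho0 : ℝ) ≤ ρ → ρ ≤ U.R.rho1 → ∀ dt : (Fin 3 → ℤ) → ℝ,
      (∀ q, castW U.R.lo q ≤ dt (holeVertex 0 q) ∧ dt (holeVertex 0 q) ≤ castW U.R.hi q) → ((U.R.loC : ℝ) ≤ dt 0 ∧ dt 0 ≤ U.R.hiC) →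
      IsChartRealisable ρ dt → (∀ p ∈ stencil 0, 0 < dt p) → poleSum dt 0 ≤ poleSum dt 1 → poleSum dt 0 ≤ poleSum dt 2 →
      (∀ a : Fin 3, dt (holeVertex 0 (a, true)) ≤ dt (holeVertex 0 (a, false))) →
      feetHoleCost 160 (3 / 100) ρ dt 0 ≤ domCapK U.u 160 (3 / 100) ρ (chargeDepth ρ dt 0) := by
  simp only [ZUnit.check, Bool.and_eq_true, decide_eq_true_eq] at h
  obtain ⟨⟨⟨hT, hnn⟩, hρ0⟩, hall⟩ := h
  intro ρ h₀ h₁ dt hbox hC hreal hpos hch1 hch2 hchp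
  obtain ⟨c, hc, hlo, hhi⟩ := sphere_cells_dispatch U.cells U.cover hT hnn hreal h₀ h₁ (by exact_mod_cast hρ0) hpos hchp
  obtain ⟨Z, hZ, rfl⟩ := List.mem_map.1 hc
  have hchk := List.all_eq_true.mp hall Z hZ
  exact (U.station Z.part).sphLaw_of_checkDXZ U.X Z.part.cell Z.slim hchk ρ h₀ h₁ dt hbox hC hreal hpos hch1 hch2 hchp hlo hhi

/-- ★★★ **SOUNDNESS OF A FLAT MIRROR UNIT** — the binders and the conclusion of 113F `SphUnit.sound` exactly (dispatch over the doubled cell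
list: a part's cell by `sphLaw_of_checkDXZ`, a mirror cell by `sphLaw_swap12`). -/
theorem ZUnit.soundM (U : ZUnit) (h : U.checkM = true) :
    ∀ ρ : ℝ, (U.R.rho0 : ℝ) ≤ ρ → ρ ≤ U.R.rho1 → ∀ dt : (Fin 3 → ℤ) → ℝ,
      (∀ q, castW U.R.lo q ≤ dt (holeVertex 0 q) ∧ dt (holeVertex 0 q) ≤ castW U.R.hi q) → ((U.R.loC : ℝ) ≤ dt 0 ∧ dt 0 ≤ U.R.hiC) →
      IsChartRealisable ρ dt → (∀ p ∈ stencil 0, 0 < dt p) → poleSum dt 0 ≤ poleSum dt 1 → poleSum dt 0 ≤ poleSum dt 2 →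
      (∀ a : Fin 3, dt (holeVertex 0 (a, true)) ≤ dt (holeVertex 0 (a, false))) →
      feetHoleCost 160 (3 / 100) ρ dt 0 ≤ domCapK U.u 160 (3 / 100) ρ (chargeDepth ρ dt 0) := by
  simp only [ZUnit.checkM, Bool.and_eq_true, decide_eq_true_eq] at h
  obtain ⟨⟨⟨⟨hT, hnn⟩, hρ0⟩, hs⟩, hall⟩ := h
  intro ρ h₀ h₁ dt hbox hC hreal hpos hch1 hch2 hchp
  obtain ⟨c, hc, hlo, hhi⟩ := sphere_cells_dispatch U.cellsM U.cover hT hnn hreal h₀ h₁ (by exact_mod_cast hρ0.le) hpos hchp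
  rcases List.mem_append.1 hc with hc | hc
  · obtain ⟨Z, hZ, rfl⟩ := List.mem_map.1 hc
    have hchk := List.all_eq_true.mp hall Z hZ
    exact (U.station Z.part).sphLaw_of_checkDXZ U.X Z.part.cell Z.slim hchk ρ h₀ h₁ dt hbox hC hreal hpos hch1 hch2 hchp hlo hhi
  · obtain ⟨c', hc', rfl⟩ := List.mem_map.1 hc
    obtain ⟨Z, hZ, rfl⟩ := List.mem_map.1 hc'
    have hchk := List.all_eq_true.mp hall Z hZ
    exact StationCert.sphLaw_swap12 ((U.station Z.part).sphLaw_of_checkDXZ U.X Z.part.cell Z.slim hchk) hs hρ0 ρ h₀ h₁ dt hbox hC hreal hpos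
      hch1 hch2 hchp hlo hhi

/-- ★ BATCH FORM over a list of mirror-checked flat units. -/
theorem ZUnit.soundM_of_all {Us : List ZUnit} (h : Us.all ZUnit.checkM = true) {U : ZUnit} (hU : U ∈ Us) :
    ∀ ρ : ℝ, (U.R.rho0 : ℝ) ≤ ρ → ρ ≤ U.R.rho1 → ∀ dt : (Fin 3 → ℤ) → ℝ,
      (∀ q, castW U.R.lo q ≤ dt (holeVertex 0 q) ∧ dt (holeVertex 0 q) ≤ castW U.R.hi q) → ((U.R.loC : ℝ) ≤ dt 0 ∧ dt 0 ≤ U.R.hiC) →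
      IsChartRealisable ρ dt → (∀ p ∈ stencil 0, 0 < dt p) → poleSum dt 0 ≤ poleSum dt 1 → poleSum dt 0 ≤ poleSum dt 2 →
      (∀ a : Fin 3, dt (holeVertex 0 (a, true)) ≤ dt (holeVertex 0 (a, false))) →
      feetHoleCost 160 (3 / 100) ρ dt 0 ≤ domCapK U.u 160 (3 / 100) ρ (chargeDepth ρ dt 0) :=
  U.soundM (List.all_eq_true.mp h U hU)

end Unit

end Summit.AtomisticToContinuum.Crystallization.Theorems.ChargedEnergyGapChartDial
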